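import Summits.Ventures.CertifiedManyBodySolver.Downfold.EmeryScalingLaw
import Summits.Ventures.CertifiedManyBodySolver.Downfold.EmeryHybridisationShapeLever
import HarnessLib

/-!
# THE OXYGEN-RAY LEVER OF THE FERMI-SURFACE SHAPE AT FIXED DOPING: scaling the two oxygen hoppings together, `(t_pp, t_pp′) ↦ λ(t_pp, t_pp′)`
# with `λ ≥ 1`, makes the one-band `t′/t` of the σ row MORE negative — and the pure `t_pp` lever at `t_pp′ = 0`; with the oxygen-ray bracket of the
# Fermi energy `ε_F/λ ≤ ε_F(λ·oxygen) ≤ λε_F + (λ − 1)Δ`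

Venture CertifiedManyBodySolver, cell `pub/hubbard-downfold` (stage S1; INFLATION-RULES-3to1-B §B.85 (h)–(l)), seat hubbard-downfold-mod-4 (technique B = band
level, g35); namespace `Summit.Ventures.CertifiedManyBodySolver.Downfold.Emery`. Everything PROVED (0 sorry, no definition). WHAT THIS IS NOT: a statement
about any material; `U = 0` one-body kinematics of the σ (d–p_x–p_y + t_pp, t_pp′) model; no number lives here.

THE ARGUMENT IS THE SCALING LAW READ SIDEWAYS. By `fsRatio_fermiEnergyOf_smul` (§B.84) the fixed-doping shape of `(Δ, t_pd, λt_pp, λt_pp′)` equals that of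
`(Δ/λ, t_pd/λ, t_pp, t_pp′)`; from there the Δ-lever (`fsRatio_fermiEnergyOf_mono_Delta`, §B.83 (g): raise `Δ/λ` to `Δ`) and the hybridisation lever
(`fsRatio_fermiEnergyOf_mono_tpd`, §B.85 (e): raise `t_pd/λ` to `t_pd`) both RAISE `t′/t` and land on the original row. No new analysis.

* §1 **THE OXYGEN-RAY LEVER** (`fsRatio_fermiEnergyOf_ray_anti`): for `λ ≥ 1`, `Δ, t_pd, t_pp > 0`, `0 ≤ t_pp′ ≤ t_pp`, `0 < ν < 1` and the sheet regime at the
  oxygen-rich row, `(λt_pp′)·ε_F(Δ, t_pd, λt_pp, λt_pp′; ν) ≤ t_pd²`: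
  **`fsRatio(Δ, t_pd, λt_pp, λt_pp′; ε_F) ≤ fsRatio(Δ, t_pd, t_pp, t_pp′; ε_F)`** (each row at its own Fermi energy of the filling `ν`).
* §2 **THE PURE `t_pp` LEVER** (`fsRatio_fermiEnergyOf_anti_tpp_pure`): at `t_pp′ = 0`, for `0 < t_pp ≤ t_pp″`: `fsRatio(t_pp″; ε_F) ≤ fsRatio(t_pp; ε_F)` with NO
  regime hypothesis — more oxygen–oxygen hopping, more negative `t′/t` at every doping; box form `fsRatio_fermiEnergyOf_mem_Icc_of_tpp_mem_pure`.
  FIXED-RATIO FORM (`fsRatio_fermiEnergyOf_anti_tpp_fixedRatio`): along `t_pp′ = κ·t_pp` (`0 ≤ κ ≤ 1`) the same monotonicity in `t_pp`.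
* §3 **THE OXYGEN-RAY BRACKET OF THE FERMI ENERGY** (`fermiEnergyOf_ray_le`, `fermiEnergyOf_le_ray`): for `λ ≥ 1`,
  `ε_F(θ)/λ ≤ ε_F(Δ, t_pd, λt_pp, λt_pp′) ≤ λ·ε_F(θ) + (λ − 1)·Δ` — equivalently `Δ + ε_F(λ·oxygen) ≤ λ(Δ + ε_F)`: the distance of the Fermi level from
  the oxygen level `ε_p = −Δ` grows at most linearly along the oxygen ray (scaling law + `t_pd` levers + the 1-Lipschitz Δ-lever of §B.83 (f)).
* §4 WHAT IS NOT SIGNED HERE: `t_pp` alone at fixed `t_pp′ > 0` and `t_pp′` alone. By scaling, `R(Δ, t_pd, λt_pp, t_pp′) = R(Δ/λ, t_pd/λ, t_pp, t_pp′/λ)`, and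
  the `t_pp′/λ < t_pp′` step goes the other way (`EmeryTppPrimeShapeLever`, conditional); the cell's box rule therefore runs along RAYS (§B.86,
  `EmeryShapeTwoRayRule`) and carries the `t_pp′` mismatch as an explicit inflation.

Sources: three-band model [HybertsenSchluterChristensen1989, Eq. (1)]; contour form [AndersenEtAl1995, §6]; arithmetic [folklore].
-/

noncomputable section

namespace Summit.Ventures.CertifiedManyBodySolver.Downfold.Emery

open Real Set

/-! ## §1 The oxygen-ray lever -/

section Ray

variable {Δ a b c l ν : ℝ}

/-- Scaling read sideways: the fixed-doping shape of `(Δ, t_pd, λt_pp, λt_pp′)` is that of `(Δ/λ, t_pd/λ, t_pp, t_pp′)` (`λ > 0`). [folklore] -/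
theorem fsRatio_fermiEnergyOf_ray_eq_scaled (hl : 0 < l) (Δ a b c ν : ℝ) :
    fsRatio Δ a (l * b) (l * c) (fermiEnergyOf Δ a (l * b) (l * c) ν) =
      fsRatio (Δ / l) (a / l) b c (fermiEnergyOf (Δ / l) (a / l) b c ν) := by
  have h := fsRatio_fermiEnergyOf_smul hl (Δ / l) (a / l) b c ν
  rw [mul_div_cancel₀ _ hl.ne', mul_div_cancel₀ _ hl.ne'] at h
  exact h

/-- The Fermi energy of the oxygen-scaled row is `λ` times that of the fully down-scaled row: `ε_F(Δ, a, λb, λc) = λ·ε_F(Δ/λ, a/λ, b, c)`. [folklore] -/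
theorem fermiEnergyOf_ray_eq_scaled (hl : 0 < l) (Δ a b c ν : ℝ) :
    fermiEnergyOf Δ a (l * b) (l * c) ν = l * fermiEnergyOf (Δ / l) (a / l) b c ν := by
  have h := fermiEnergyOf_smul hl (Δ / l) (a / l) b c ν
  rw [mul_div_cancel₀ _ hl.ne', mul_div_cancel₀ _ hl.ne'] at h
  exact h

/-- **THE OXYGEN-RAY LEVER**: for `λ ≥ 1` (sheet regime at the oxygen-rich row),
`fsRatio(Δ, t_pd, λt_pp, λt_pp′; ε_F) ≤ fsRatio(Δ, t_pd, t_pp, t_pp′; ε_F)` at every fixed filling. [folklore] -/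
theorem fsRatio_fermiEnergyOf_ray_anti (hΔ : 0 < Δ) (ha : 0 < a) (hb : 0 < b) (hc : 0 ≤ c) (hcb : c ≤ b) (hl : 1 ≤ l)
    (hν0 : 0 < ν) (hν1 : ν < 1) (hreg : l * c * fermiEnergyOf Δ a (l * b) (l * c) ν ≤ a ^ 2) :
    fsRatio Δ a (l * b) (l * c) (fermiEnergyOf Δ a (l * b) (l * c) ν) ≤ fsRatio Δ a b c (fermiEnergyOf Δ a b c ν) := by
  have hl0 : 0 < l := by linarith
  have hΔl : 0 < Δ / l := div_pos hΔ hl0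
  have hal : 0 < a / l := div_pos ha hl0
  rw [fsRatio_fermiEnergyOf_ray_eq_scaled hl0]
  -- regime at the down-scaled row (Δ/λ, a/λ, b, c): c·ε_F = c·ε_F(Δ, a, λb, λc)/λ ≤ (a/λ)²
  have hE : fermiEnergyOf (Δ / l) (a / l) b c ν = fermiEnergyOf Δ a (l * b) (l * c) ν / l := by
    rw [fermiEnergyOf_ray_eq_scaled hl0, mul_div_cancel_left₀ _ hl0.ne']
  have hreg1 : c * fermiEnergyOf (Δ / l) (a / l) b c ν ≤ (a / l) ^ 2 := by
    rw [hE, div_pow, le_div_iff₀ (by positivity)]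
    calc c * (fermiEnergyOf Δ a (l * b) (l * c) ν / l) * l ^ 2 = l * c * fermiEnergyOf Δ a (l * b) (l * c) ν := by
          field_simp
      _ ≤ a ^ 2 := hreg
  -- attainment at the three rows of the chain
  have hΔsplit : Δ / l + (Δ - Δ / l) = Δ := by ring
  have hδ : 0 ≤ Δ - Δ / l := by
    rw [sub_nonneg, div_le_iff₀ hl0]; nlinarith
  obtain ⟨e1, -, he1⟩ := exists_fermiEnergy_of_mem_Ioo hΔl hal.ne' hc hb.le hν0 hν1
  obtain ⟨e2, -, he2⟩ := exists_fermiEnergy_of_mem_Ioo hΔ hal.ne' hc hb.le hν0 hν1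
  -- step 1: raise Δ/λ to Δ (Δ-lever, §B.83 (g))
  have s1 : fsRatio (Δ / l) (a / l) b c (fermiEnergyOf (Δ / l) (a / l) b c ν) ≤
      fsRatio Δ (a / l) b c (fermiEnergyOf Δ (a / l) b c ν) := by
    have h := fsRatio_fermiEnergyOf_mono_Delta (δ := Δ - Δ / l) hΔl hal.ne' hb hc hcb hδ hν0 hν1 ⟨e1, he1⟩
      (by rw [hΔsplit]; exact ⟨e2, he2⟩) hreg1
    rwa [hΔsplit] at h
  -- regime at (Δ, a/λ, b, c): its Fermi energy is below that of (Δ/λ, a/λ, b, c)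
  have hreg2 : c * fermiEnergyOf Δ (a / l) b c ν ≤ (a / l) ^ 2 := by
    have hmono : fermiEnergyOf Δ (a / l) b c ν ≤ fermiEnergyOf (Δ / l) (a / l) b c ν := by
      have h := fermiEnergyOf_shift_le (δ := Δ - Δ / l) hΔl hal.ne' hc hb.le hδ hν0 hν1 ⟨e1, he1⟩ (by rw [hΔsplit]; exact ⟨e2, he2⟩)
      rwa [hΔsplit] at h
    exact le_trans (mul_le_mul_of_nonneg_left hmono hc) hreg1
  -- step 2: raise a/λ to a (hybridisation lever, §B.85 (e))
  have s2 : fsRatio Δ (a / l) b c (fermiEnergyOf Δ (a / l) b c ν) ≤ fsRatio Δ a b c (fermiEnergyOf Δ a b c ν) :=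
    fsRatio_fermiEnergyOf_mono_tpd' hΔ hal (by rw [div_le_iff₀ hl0]; nlinarith) hb hc hcb hν0 hν1 hreg2
  exact s1.trans s2

/-- Two oxygen-ray rows compared directly: for `0 < t_pp ≤ t_pp″` and `t_pp′″/t_pp″ = t_pp′/t_pp` — stated as `(b″, c″) = (l·b, l·c)` with `l = b″/b`.
General-endpoint form: `0 < b ≤ b'`, `c' = c·b'/b`. [folklore] -/
theorem fsRatio_fermiEnergyOf_ray_anti' {b' : ℝ} (hΔ : 0 < Δ) (ha : 0 < a) (hb : 0 < b) (hbb : b ≤ b') (hc : 0 ≤ c) (hcb : c ≤ b)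
    (hν0 : 0 < ν) (hν1 : ν < 1) (hreg : (c * b' / b) * fermiEnergyOf Δ a b' (c * b' / b) ν ≤ a ^ 2) :
    fsRatio Δ a b' (c * b' / b) (fermiEnergyOf Δ a b' (c * b' / b) ν) ≤ fsRatio Δ a b c (fermiEnergyOf Δ a b c ν) := by
  have hl : 1 ≤ b' / b := by rw [le_div_iff₀ hb]; linarith
  have h2 : c * b' / b = b' / b * c := by field_simp
  have h := fsRatio_fermiEnergyOf_ray_anti (l := b' / b) hΔ ha hb hc hcb hl hν0 hν1
    (by rw [← h2, show b' / b * b = b' by field_simp]; exact hreg)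
  rwa [show b' / b * b = b' by field_simp, ← h2] at h

end Ray

/-! ## §2 The pure `t_pp` lever and the fixed-ratio form -/

section Pure

variable {Δ a b ν : ℝ}

/-- **THE PURE `t_pp` LEVER** (`t_pp′ = 0`): for `0 < t_pp ≤ t_pp″`, `fsRatio(t_pp″; ε_F) ≤ fsRatio(t_pp; ε_F)` at every fixed filling — more oxygen–oxygen
hopping makes `t′/t` more negative; NO regime hypothesis. [folklore] -/
theorem fsRatio_fermiEnergyOf_anti_tpp_pure {b' : ℝ} (hΔ : 0 < Δ) (ha : 0 < a) (hb : 0 < b) (hbb : b ≤ b') (hν0 : 0 < ν) (hν1 : ν < 1) :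
    fsRatio Δ a b' 0 (fermiEnergyOf Δ a b' 0 ν) ≤ fsRatio Δ a b 0 (fermiEnergyOf Δ a b 0 ν) := by
  have h := fsRatio_fermiEnergyOf_ray_anti' hΔ ha hb hbb le_rfl hb.le hν0 hν1
    (by rw [zero_mul, zero_div, zero_mul]; positivity)
  rwa [zero_mul, zero_div] at h

/-- **TWO-CORNER RULE IN `t_pp` (pure rows)**: for `b₁ ≤ t_pp ≤ b₂` (`t_pp′ = 0`, all else fixed) the fixed-doping `t′/t` lies between its values at
`b₂` (low end) and `b₁` (high end). [folklore] -/
theorem fsRatio_fermiEnergyOf_mem_Icc_of_tpp_mem_pure {b₁ b₂ : ℝ} (hΔ : 0 < Δ) (ha : 0 < a) (hb₁ : 0 < b₁) (h1 : b₁ ≤ b) (h2 : b ≤ b₂)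
    (hν0 : 0 < ν) (hν1 : ν < 1) :
    fsRatio Δ a b 0 (fermiEnergyOf Δ a b 0 ν) ∈
      Icc (fsRatio Δ a b₂ 0 (fermiEnergyOf Δ a b₂ 0 ν)) (fsRatio Δ a b₁ 0 (fermiEnergyOf Δ a b₁ 0 ν)) :=
  ⟨fsRatio_fermiEnergyOf_anti_tpp_pure hΔ ha (lt_of_lt_of_le hb₁ h1) h2 hν0 hν1,
    fsRatio_fermiEnergyOf_anti_tpp_pure hΔ ha hb₁ h1 hν0 hν1⟩

/-- **FIXED-RATIO FORM**: along `t_pp′ = κ·t_pp` (`0 ≤ κ ≤ 1`), for `0 < t_pp ≤ t_pp″` and the sheet regime at the larger `t_pp″`,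
`fsRatio(t_pp″, κt_pp″; ε_F) ≤ fsRatio(t_pp, κt_pp; ε_F)`. [folklore] -/
theorem fsRatio_fermiEnergyOf_anti_tpp_fixedRatio {b' κ : ℝ} (hΔ : 0 < Δ) (ha : 0 < a) (hb : 0 < b) (hbb : b ≤ b') (hκ0 : 0 ≤ κ) (hκ1 : κ ≤ 1)
    (hν0 : 0 < ν) (hν1 : ν < 1) (hreg : κ * b' * fermiEnergyOf Δ a b' (κ * b') ν ≤ a ^ 2) :
    fsRatio Δ a b' (κ * b') (fermiEnergyOf Δ a b' (κ * b') ν) ≤ fsRatio Δ a b (κ * b) (fermiEnergyOf Δ a b (κ * b) ν) := by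
  have hcb : κ * b ≤ b := by nlinarith
  have hkey : κ * b * b' / b = κ * b' := by field_simp
  have h := fsRatio_fermiEnergyOf_ray_anti' (c := κ * b) hΔ ha hb hbb (by positivity) hcb hν0 hν1 (by rw [hkey]; exact hreg)
  rwa [hkey] at h

end Pure

/-! ## §3 The oxygen-ray bracket of the Fermi energy -/

section Bracket

variable {Δ a b c l ν : ℝ}

/-- **Upper end: `ε_F(Δ, t_pd, λt_pp, λt_pp′) ≤ λ·ε_F(θ) + (λ − 1)·Δ`**, i.e. `Δ + ε_F(λ·oxygen) ≤ λ·(Δ + ε_F(θ))` (`λ ≥ 1`; certificate-free). [folklore] -/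
theorem fermiEnergyOf_ray_le (hΔ : 0 < Δ) (ha : 0 < a) (hc : 0 ≤ c) (hb : 0 ≤ b) (hl : 1 ≤ l) (hν0 : 0 < ν) (hν1 : ν < 1) :
    fermiEnergyOf Δ a (l * b) (l * c) ν ≤ l * fermiEnergyOf Δ a b c ν + (l - 1) * Δ := by
  have hl0 : 0 < l := by linarith
  have hΔl : 0 < Δ / l := div_pos hΔ hl0
  have hal : 0 < a / l := div_pos ha hl0
  have hΔsplit : Δ / l + (Δ - Δ / l) = Δ := by ring
  have hδ : 0 ≤ Δ - Δ / l := by rw [sub_nonneg, div_le_iff₀ hl0]; nlinarith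
  rw [fermiEnergyOf_ray_eq_scaled hl0]
  -- ε_F(Δ/λ, a/λ) ≤ ε_F(Δ/λ, a) ≤ ε_F(Δ, a) + (Δ − Δ/λ)
  obtain ⟨e1, -, he1⟩ := exists_fermiEnergy_of_mem_Ioo hΔl hal.ne' hc hb hν0 hν1
  obtain ⟨e2, -, he2⟩ := exists_fermiEnergy_of_mem_Ioo hΔl ha.ne' hc hb hν0 hν1
  obtain ⟨e3, -, he3⟩ := exists_fermiEnergy_of_mem_Ioo hΔ ha.ne' hc hb hν0 hν1
  have s1 : fermiEnergyOf (Δ / l) (a / l) b c ν ≤ fermiEnergyOf (Δ / l) a b c ν :=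
    fermiEnergyOf_mono_tpdSq hΔl.le hc hb (by rw [div_pow]; exact div_le_self (sq_nonneg a) (by nlinarith)) hν0 hν1 ⟨e1, he1⟩ ⟨e2, he2⟩
  have s2 : fermiEnergyOf (Δ / l) a b c ν - (Δ - Δ / l) ≤ fermiEnergyOf Δ a b c ν := by
    have h := fermiEnergyOf_sub_le_shift (δ := Δ - Δ / l) hΔl.le hc hb hδ hν0 hν1 ⟨e2, he2⟩ (by rw [hΔsplit]; exact ⟨e3, he3⟩)
    rwa [hΔsplit] at h
  have hkey : fermiEnergyOf (Δ / l) (a / l) b c ν ≤ fermiEnergyOf Δ a b c ν + (Δ - Δ / l) := by linarith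
  calc l * fermiEnergyOf (Δ / l) (a / l) b c ν ≤ l * (fermiEnergyOf Δ a b c ν + (Δ - Δ / l)) := mul_le_mul_of_nonneg_left hkey hl0.le
    _ = l * fermiEnergyOf Δ a b c ν + (l - 1) * Δ := by rw [mul_add, mul_sub, mul_div_cancel₀ _ hl0.ne']; ring

/-- **Lower end: `ε_F(θ) ≤ λ·ε_F(Δ, t_pd, λt_pp, λt_pp′)`** (`λ ≥ 1`; certificate-free): the sub-quadratic `t_pd` law down the ray. [folklore] -/
theorem fermiEnergyOf_le_ray (hΔ : 0 < Δ) (ha : 0 < a) (hc : 0 ≤ c) (hb : 0 ≤ b) (hl : 1 ≤ l) (hν0 : 0 < ν) (hν1 : ν < 1) :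
    fermiEnergyOf Δ a b c ν ≤ l * fermiEnergyOf Δ a (l * b) (l * c) ν := by
  have hl0 : 0 < l := by linarith
  have hΔl : 0 < Δ / l := div_pos hΔ hl0
  have hal : 0 < a / l := div_pos ha hl0
  have hΔsplit : Δ / l + (Δ - Δ / l) = Δ := by ring
  have hδ : 0 ≤ Δ - Δ / l := by rw [sub_nonneg, div_le_iff₀ hl0]; nlinarith
  rw [fermiEnergyOf_ray_eq_scaled hl0]
  -- ε_F(Δ, a) = ε_F(Δ, λ·(a/λ)) ≤ λ²·ε_F(Δ, a/λ) ≤ λ²·ε_F(Δ/λ, a/λ)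
  obtain ⟨e1, -, he1⟩ := exists_fermiEnergy_of_mem_Ioo hΔl hal.ne' hc hb hν0 hν1
  obtain ⟨e2, -, he2⟩ := exists_fermiEnergy_of_mem_Ioo hΔ hal.ne' hc hb hν0 hν1
  have s1 : fermiEnergyOf Δ a b c ν ≤ l ^ 2 * fermiEnergyOf Δ (a / l) b c ν := by
    have h := fermiEnergyOf_tpd_le_sq_mul' (μ := l) (a := a / l) hΔ hal.ne' hc hb hl hν0 hν1
    rwa [mul_div_cancel₀ _ hl0.ne'] at h
  have s2 : fermiEnergyOf Δ (a / l) b c ν ≤ fermiEnergyOf (Δ / l) (a / l) b c ν := by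
    have h := fermiEnergyOf_shift_le (δ := Δ - Δ / l) hΔl hal.ne' hc hb hδ hν0 hν1 ⟨e1, he1⟩ (by rw [hΔsplit]; exact ⟨e2, he2⟩)
    rwa [hΔsplit] at h
  have hF0 : 0 ≤ fermiEnergyOf (Δ / l) (a / l) b c ν := (fermiEnergyOf_pos hΔl hal.ne' hc hb hν0 hν1).le
  calc fermiEnergyOf Δ a b c ν ≤ l ^ 2 * fermiEnergyOf Δ (a / l) b c ν := s1
    _ ≤ l ^ 2 * fermiEnergyOf (Δ / l) (a / l) b c ν := mul_le_mul_of_nonneg_left s2 (sq_nonneg l)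
    _ ≤ l * (l * fermiEnergyOf (Δ / l) (a / l) b c ν) := by ring_nf; exact le_rfl

/-- **THE OXYGEN-RAY BRACKET** as one statement: `ε_F(θ)/λ ≤ ε_F(Δ, t_pd, λt_pp, λt_pp′) ≤ λε_F(θ) + (λ − 1)Δ`. [folklore] -/
theorem fermiEnergyOf_ray_mem_Icc (hΔ : 0 < Δ) (ha : 0 < a) (hc : 0 ≤ c) (hb : 0 ≤ b) (hl : 1 ≤ l) (hν0 : 0 < ν) (hν1 : ν < 1) :
    fermiEnergyOf Δ a (l * b) (l * c) ν ∈
      Icc (fermiEnergyOf Δ a b c ν / l) (l * fermiEnergyOf Δ a b c ν + (l - 1) * Δ) := by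
  have hl0 : 0 < l := by linarith
  refine ⟨?_, fermiEnergyOf_ray_le hΔ ha hc hb hl hν0 hν1⟩
  rw [div_le_iff₀ hl0, mul_comm]
  exact fermiEnergyOf_le_ray hΔ ha hc hb hl hν0 hν1

end Bracket

end Summit.Ventures.CertifiedManyBodySolver.Downfold.Emery
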